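import Literature.AnabelianGeometry.EtaleTheta.Discharge.Sec3Prop34iConnectedOfGaloisCovering
import HarnessLib

/-!
# [EtTh] Remark 3.3.1 at the constructed Def. 3.3 (iii) data: the primes of `Φ₀(S) = Hom_G(S, Div⁺(Z^log_∞))`
# ARE the diagonal `G`-orbits of prime log-divisors — the bijection (proof-only)

S. Mochizuki, *The étale theta function and its Frobenioid-theoretic manifestations*, Publ. RIMS **45** (2009)
[MochizukiEtTh2009], §3, Remark 3.3.1, PRIMS PDF p. 73 l. 101 – p. 74 l. 9 (printed pp. 299–300): «Note that the set
of primes [cf. [FrdI], §0] of the monoid `Div⁺(Z^log_∞)^{Gal(Z^log_∞/Y^log)}` appearing in the definition of `Φ₀(Y^log)`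
is in natural bijective correspondence with the set of `Gal(Z^log_∞/Y^log)`-orbits of prime log-divisors on `Z^log_∞`
[cf. Proposition 3.2, (i)].» [cite: MochizukiEtTh2009, Rmk 3.3.1 p.73]; [FrdI] §0 p. 12 (primary elements, `≼`,
`Prime(M)` = `≼`-classes of primary elements) [cite: MochizukiFrdI2008, §0 p.12].

PROOF-ONLY companion (theorems only: no `def`, no instance, no `Prop` fact; nothing frozen is edited) of
abc-iut-w6-d058's `Discharge/Sec3Prop34iConnectedOfGaloisCovering.lean` (p438397), whose §«Orbit indicators» proves ONE
direction of the remark at the constructed Def. 3.3 (iii) data — one universal combinatorial covering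
`Z : LogDivisorModel`, its Galois action `A : Z.GaloisAction G`, a covering `S` dominated by it typed as a `G`-set, and
`Φ₀(S) = Hom_G(S, Div⁺(Z^log_∞))` read as `G`-invariant multiplicity functions on `S × (cusps ⊔ components)`:
the `n`-fold indicator `q_O` of a diagonal orbit `O = G·(s₀, x₀)` lies in `Φ₀(S)` (`exists_orbitIndicator`) and is
PRIMARY (`isPrimary_of_orbitIndicator`).  abc-iut cell, layer L2, seat abc-iut-L2-t12 (gen 10), L2 ROWS #136 R1071
menu M14 «§3 REMARKS» census mover «RMK331-PRIMES-SURJ».  THIS FILE closes the bijection: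

* `exists_mult_pos_of_ne_one` — a non-trivial `p ∈ Φ₀(S)` has a positive multiplicity somewhere;
* `orbitIndicator_precsim_of_mult_pos` — if `p` has positive multiplicity at `(s₀, x₀)` then `q_O ≼ p` for the
  indicator `q_O` of `O = G·(s₀, x₀)` (invariance of multiplicities + `dvd_of_mult_le`);
* `precsim_orbitIndicator_of_isPrimary` — hence `p ≼ q_O` when `p` is primary;
* **`isPrimary_iff_precsim_orbitIndicator`** — `p` is primary iff it is `≼`-equivalent to some orbit indicator;
* `mem_orbit_of_orbitIndicator_precsim` / **`orbitIndicator_precsim_iff`** — `q_O ≼ q_{O'}` iff `O = O'`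
  (INJECTIVITY of `O ↦ [q_O]`);
* **`exists_orbitIndicator_mk_eq`** — every prime `𝔭 ∈ Prime(Φ₀(S))` is the class of an orbit indicator
  (SURJECTIVITY of `O ↦ [q_O]`); **`orbitIndicator_mk_eq_mk_iff`** — two orbit indicators define the same prime iff
  their orbits coincide.

Together with p438397: «primes of `Φ₀(S)` ↔ diagonal `G`-orbits on `S × Idx`» — for `S = G/H` connected these are the
`H = Gal(Z^log_∞/Y^log)`-orbits of prime log-divisors `Idx` of `Z^log_∞`, i.e. the remark AS PRINTED at ONE term of the
inductive limit of Def. 3.3 (iii) (the second sentence of the remark — transition maps between different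
`Δ^fil`-closures — concerns the un-typed inductive system and is not addressed).  HONEST FRAMING: theorems about a
construction over typed interfaces; refereed pre-IUT material; nothing here bears on [IUTchIII] Cor. 3.12; no side
taken; typed ≠ proved for anything not stated here.
-/

namespace Literature.AnabelianGeometry.EtaleTheta

open CategoryTheory Opposite Literature.AlgebraicGeometry.Frobenioids

universe u

namespace LogDivisorModel.GaloisAction

variable {Z : LogDivisorModel.{u}} {G : Type u} [Group G] (A : Z.GaloisAction G) (S : Action (Type u) G)

/-! ## A non-trivial invariant divisor has a positive multiplicity -/

/-- A non-trivial element of `Φ₀(S)` has positive multiplicity at some `(s, x)`. [cite: MochizukiEtTh2009, Rmk 3.3.1 p.73] -/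
theorem exists_mult_pos_of_ne_one {p : A.phiZero S} (hp : p ≠ 1) :
    ∃ (s : S.V) (x : Z.Idx), 0 < Z.mult ⟨p.1 s, (p.2.1 s).2⟩ x := by
  by_contra h
  push Not at h
  refine hp (A.phiZero_ext S fun s x => ?_)
  rw [show Z.mult ⟨(1 : A.phiZero S).1 s, ((1 : A.phiZero S).2.1 s).2⟩ x = 0 from Z.mult_one x]
  exact Nat.le_zero.mp (h s x)

/-- The diagonal orbit relation is reflexive. [cite: MochizukiEtTh2009, Rmk 3.3.1 p.73] -/
theorem mem_orbit_refl (s₀ : S.V) (x₀ : Z.Idx) : ∃ g : G, S.ρ g s₀ = s₀ ∧ A.permIdx g x₀ = x₀ :=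
  ⟨1, by rw [map_one]; rfl, by rw [map_one, Equiv.Perm.one_apply]⟩

/-- The diagonal orbit relation is symmetric. [cite: MochizukiEtTh2009, Rmk 3.3.1 p.73] -/
theorem mem_orbit_symm {s₀ s : S.V} {x₀ x : Z.Idx} (h : ∃ g : G, S.ρ g s₀ = s ∧ A.permIdx g x₀ = x) :
    ∃ g : G, S.ρ g s = s₀ ∧ A.permIdx g x = x₀ := by
  obtain ⟨g, rfl, rfl⟩ := h
  refine ⟨g⁻¹, ?_, ?_⟩
  · rw [← types_comp_apply (S.ρ g) (S.ρ g⁻¹), ← End.mul_def, ← map_mul, inv_mul_cancel, map_one]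
    rfl
  · rw [← Equiv.Perm.mul_apply, ← map_mul, inv_mul_cancel, map_one, Equiv.Perm.one_apply]

/-- The diagonal orbit relation is transitive. [cite: MochizukiEtTh2009, Rmk 3.3.1 p.73] -/
theorem mem_orbit_trans {s₀ s₁ s₂ : S.V} {x₀ x₁ x₂ : Z.Idx} (h₁ : ∃ g : G, S.ρ g s₀ = s₁ ∧ A.permIdx g x₀ = x₁)
    (h₂ : ∃ g : G, S.ρ g s₁ = s₂ ∧ A.permIdx g x₁ = x₂) : ∃ g : G, S.ρ g s₀ = s₂ ∧ A.permIdx g x₀ = x₂ := by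
  obtain ⟨g, rfl, rfl⟩ := h₁
  obtain ⟨g', rfl, rfl⟩ := h₂
  refine ⟨g' * g, ?_, ?_⟩
  · rw [map_mul]; rfl
  · rw [map_mul, Equiv.Perm.mul_apply]

/-! ## Every primary element is `≼`-equivalent to an orbit indicator -/

/-- If `p ∈ Φ₀(S)` has positive multiplicity at `(s₀, x₀)`, the orbit indicator `q` of `(s₀, x₀)` satisfies `q ≼ p`:
indeed `q ∣ p ^ n` (`n` = the Cartier exponent), multiplicities of `p` being constant `≥ 1` along the orbit.
[cite: MochizukiEtTh2009, Rmk 3.3.1 p.73] -/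
theorem orbitIndicator_precsim_of_mult_pos {s₀ : S.V} {x₀ : Z.Idx} {q : A.phiZero S}
    (hq : ∀ s x, ((∃ g : G, S.ρ g s₀ = s ∧ A.permIdx g x₀ = x) → Z.mult ⟨q.1 s, (q.2.1 s).2⟩ x = (Z.cartierExp : ℕ)) ∧
      ((¬ ∃ g : G, S.ρ g s₀ = s ∧ A.permIdx g x₀ = x) → Z.mult ⟨q.1 s, (q.2.1 s).2⟩ x = 0))
    {p : A.phiZero S} (hp : 0 < Z.mult ⟨p.1 s₀, (p.2.1 s₀).2⟩ x₀) : q ≼ p := by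
  refine ⟨(Z.cartierExp : ℕ), Z.cartierExp.pos, A.dvd_of_mult_le S fun s x => ?_⟩
  rw [mult_phiZero_pow]
  by_cases h : ∃ g : G, S.ρ g s₀ = s ∧ A.permIdx g x₀ = x
  · rw [(hq s x).1 h]
    obtain ⟨g, rfl, rfl⟩ := h
    rw [A.mult_phiZero_ρ S p g s₀ x₀]
    exact Nat.le_mul_of_pos_right _ hp
  · rw [(hq s x).2 h]
    exact Nat.zero_le _

/-- A PRIMARY `p ∈ Φ₀(S)` with positive multiplicity at `(s₀, x₀)` satisfies `p ≼ q` for the orbit indicator `q` of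
`(s₀, x₀)`. [cite: MochizukiEtTh2009, Rmk 3.3.1 p.73] -/
theorem precsim_orbitIndicator_of_isPrimary {s₀ : S.V} {x₀ : Z.Idx} {q : A.phiZero S}
    (hq : ∀ s x, ((∃ g : G, S.ρ g s₀ = s ∧ A.permIdx g x₀ = x) → Z.mult ⟨q.1 s, (q.2.1 s).2⟩ x = (Z.cartierExp : ℕ)) ∧
      ((¬ ∃ g : G, S.ρ g s₀ = s ∧ A.permIdx g x₀ = x) → Z.mult ⟨q.1 s, (q.2.1 s).2⟩ x = 0))
    {p : A.phiZero S} (hP : IsPrimary p) (hp : 0 < Z.mult ⟨p.1 s₀, (p.2.1 s₀).2⟩ x₀) : p ≼ q :=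
  hP.2 q (A.isPrimary_of_orbitIndicator S hq).1 (A.orbitIndicator_precsim_of_mult_pos S hq hp)

/-- **`p ∈ Φ₀(S)` is primary iff it is `≼`-equivalent to the indicator of some diagonal `G`-orbit** (Rmk. 3.3.1: "the
primes … [are] the … orbits of prime log-divisors"). [cite: MochizukiEtTh2009, Rmk 3.3.1 p.73] -/
theorem isPrimary_iff_precsim_orbitIndicator (p : A.phiZero S) :
    IsPrimary p ↔ ∃ (s₀ : S.V) (x₀ : Z.Idx) (q : A.phiZero S),
      (∀ s x, ((∃ g : G, S.ρ g s₀ = s ∧ A.permIdx g x₀ = x) → Z.mult ⟨q.1 s, (q.2.1 s).2⟩ x = (Z.cartierExp : ℕ)) ∧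
        ((¬ ∃ g : G, S.ρ g s₀ = s ∧ A.permIdx g x₀ = x) → Z.mult ⟨q.1 s, (q.2.1 s).2⟩ x = 0)) ∧
      p ≼ q ∧ q ≼ p := by
  constructor
  · intro hP
    obtain ⟨s₀, x₀, hpos⟩ := A.exists_mult_pos_of_ne_one S hP.1
    obtain ⟨q, hq⟩ := A.exists_orbitIndicator S s₀ x₀
    exact ⟨s₀, x₀, q, hq, A.precsim_orbitIndicator_of_isPrimary S hq hP hpos,
      A.orbitIndicator_precsim_of_mult_pos S hq hpos⟩
  · rintro ⟨s₀, x₀, q, hq, hpq, hqp⟩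
    have hQ := A.isPrimary_of_orbitIndicator S hq
    refine hQ.of_precsim hpq fun h1 => hQ.1 ?_
    -- `q ≼ p = 1` forces `q = 1`
    obtain ⟨n, -, hdvd⟩ := hqp
    rw [h1, one_pow] at hdvd
    refine A.phiZero_ext S fun s x => ?_
    have hle := A.mult_le_of_dvd S hdvd s x
    rw [show Z.mult ⟨(1 : A.phiZero S).1 s, ((1 : A.phiZero S).2.1 s).2⟩ x = 0 from Z.mult_one x] at hle ⊢
    exact Nat.le_zero.mp hle

/-! ## Injectivity: `q_O ≼ q_{O'}` iff `O = O'` -/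

/-- If the indicator of the orbit of `(s₀, x₀)` is `≼` the indicator of the orbit of `(s₁, x₁)`, then `(s₀, x₀)` lies
in the orbit of `(s₁, x₁)`. [cite: MochizukiEtTh2009, Rmk 3.3.1 p.73] -/
theorem mem_orbit_of_orbitIndicator_precsim {s₀ s₁ : S.V} {x₀ x₁ : Z.Idx} {q q' : A.phiZero S}
    (hq : ∀ s x, ((∃ g : G, S.ρ g s₀ = s ∧ A.permIdx g x₀ = x) → Z.mult ⟨q.1 s, (q.2.1 s).2⟩ x = (Z.cartierExp : ℕ)) ∧
      ((¬ ∃ g : G, S.ρ g s₀ = s ∧ A.permIdx g x₀ = x) → Z.mult ⟨q.1 s, (q.2.1 s).2⟩ x = 0))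
    (hq' : ∀ s x, ((∃ g : G, S.ρ g s₁ = s ∧ A.permIdx g x₁ = x) → Z.mult ⟨q'.1 s, (q'.2.1 s).2⟩ x = (Z.cartierExp : ℕ)) ∧
      ((¬ ∃ g : G, S.ρ g s₁ = s ∧ A.permIdx g x₁ = x) → Z.mult ⟨q'.1 s, (q'.2.1 s).2⟩ x = 0))
    (h : q ≼ q') : ∃ g : G, S.ρ g s₁ = s₀ ∧ A.permIdx g x₁ = x₀ := by
  by_contra hnot
  have hzero := (A.mult_of_precsim_orbitIndicator S hq' h s₀ x₀).2 hnot
  rw [(hq s₀ x₀).1 (A.mem_orbit_refl S s₀ x₀)] at hzero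
  exact absurd hzero (ne_of_gt Z.cartierExp.pos)

/-- Conversely, points of ONE orbit have `≼`-comparable (indeed `≼`-equivalent) indicators.
[cite: MochizukiEtTh2009, Rmk 3.3.1 p.73] -/
theorem orbitIndicator_precsim_of_mem_orbit {s₀ s₁ : S.V} {x₀ x₁ : Z.Idx} {q q' : A.phiZero S}
    (hq : ∀ s x, ((∃ g : G, S.ρ g s₀ = s ∧ A.permIdx g x₀ = x) → Z.mult ⟨q.1 s, (q.2.1 s).2⟩ x = (Z.cartierExp : ℕ)) ∧
      ((¬ ∃ g : G, S.ρ g s₀ = s ∧ A.permIdx g x₀ = x) → Z.mult ⟨q.1 s, (q.2.1 s).2⟩ x = 0))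
    (hq' : ∀ s x, ((∃ g : G, S.ρ g s₁ = s ∧ A.permIdx g x₁ = x) → Z.mult ⟨q'.1 s, (q'.2.1 s).2⟩ x = (Z.cartierExp : ℕ)) ∧
      ((¬ ∃ g : G, S.ρ g s₁ = s ∧ A.permIdx g x₁ = x) → Z.mult ⟨q'.1 s, (q'.2.1 s).2⟩ x = 0))
    (h : ∃ g : G, S.ρ g s₁ = s₀ ∧ A.permIdx g x₁ = x₀) : q ≼ q' := by
  -- `q'` has multiplicity `n > 0` at `(s₀, x₀)`, a point of its own orbit
  refine A.orbitIndicator_precsim_of_mult_pos S hq ?_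
  rw [(hq' s₀ x₀).1 h]
  exact Z.cartierExp.pos

/-- **Injectivity of `O ↦ q_O` up to `≼`**: `q_O ≼ q_{O'}` iff `(s₀, x₀) ∈ O'` (iff `O = O'`).
[cite: MochizukiEtTh2009, Rmk 3.3.1 p.73] -/
theorem orbitIndicator_precsim_iff {s₀ s₁ : S.V} {x₀ x₁ : Z.Idx} {q q' : A.phiZero S}
    (hq : ∀ s x, ((∃ g : G, S.ρ g s₀ = s ∧ A.permIdx g x₀ = x) → Z.mult ⟨q.1 s, (q.2.1 s).2⟩ x = (Z.cartierExp : ℕ)) ∧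
      ((¬ ∃ g : G, S.ρ g s₀ = s ∧ A.permIdx g x₀ = x) → Z.mult ⟨q.1 s, (q.2.1 s).2⟩ x = 0))
    (hq' : ∀ s x, ((∃ g : G, S.ρ g s₁ = s ∧ A.permIdx g x₁ = x) → Z.mult ⟨q'.1 s, (q'.2.1 s).2⟩ x = (Z.cartierExp : ℕ)) ∧
      ((¬ ∃ g : G, S.ρ g s₁ = s ∧ A.permIdx g x₁ = x) → Z.mult ⟨q'.1 s, (q'.2.1 s).2⟩ x = 0)) :
    q ≼ q' ↔ ∃ g : G, S.ρ g s₁ = s₀ ∧ A.permIdx g x₁ = x₀ :=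
  ⟨A.mem_orbit_of_orbitIndicator_precsim S hq hq', A.orbitIndicator_precsim_of_mem_orbit S hq hq'⟩

/-! ## The bijection `Prime(Φ₀(S)) ↔ {diagonal G-orbits}` ([FrdI] §0: primes = `≼`-classes of primary elements) -/

/-- **SURJECTIVITY — every prime of `Φ₀(S)` is the class of an orbit indicator.** [cite: MochizukiEtTh2009, Rmk 3.3.1 p.73] -/
theorem exists_orbitIndicator_mk_eq (𝔭 : Primes (A.phiZero S)) :
    ∃ (s₀ : S.V) (x₀ : Z.Idx) (q : A.phiZero S) (hq : ∀ s x,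
        ((∃ g : G, S.ρ g s₀ = s ∧ A.permIdx g x₀ = x) → Z.mult ⟨q.1 s, (q.2.1 s).2⟩ x = (Z.cartierExp : ℕ)) ∧
        ((¬ ∃ g : G, S.ρ g s₀ = s ∧ A.permIdx g x₀ = x) → Z.mult ⟨q.1 s, (q.2.1 s).2⟩ x = 0)),
      Quotient.mk (primarySetoid (A.phiZero S)) ⟨q, A.isPrimary_of_orbitIndicator S hq⟩ = 𝔭 := by
  induction 𝔭 using Quotient.inductionOn with
  | h p =>
    obtain ⟨p, hP⟩ := p
    obtain ⟨s₀, x₀, hpos⟩ := A.exists_mult_pos_of_ne_one S hP.1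
    obtain ⟨q, hq⟩ := A.exists_orbitIndicator S s₀ x₀
    exact ⟨s₀, x₀, q, hq, Quotient.sound (A.orbitIndicator_precsim_of_mult_pos S hq hpos)⟩

/-- **INJECTIVITY — two orbit indicators define the same prime of `Φ₀(S)` iff their orbits coincide.**
[cite: MochizukiEtTh2009, Rmk 3.3.1 p.73] -/
theorem orbitIndicator_mk_eq_mk_iff {s₀ s₁ : S.V} {x₀ x₁ : Z.Idx} {q q' : A.phiZero S}
    (hq : ∀ s x, ((∃ g : G, S.ρ g s₀ = s ∧ A.permIdx g x₀ = x) → Z.mult ⟨q.1 s, (q.2.1 s).2⟩ x = (Z.cartierExp : ℕ)) ∧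
      ((¬ ∃ g : G, S.ρ g s₀ = s ∧ A.permIdx g x₀ = x) → Z.mult ⟨q.1 s, (q.2.1 s).2⟩ x = 0))
    (hq' : ∀ s x, ((∃ g : G, S.ρ g s₁ = s ∧ A.permIdx g x₁ = x) → Z.mult ⟨q'.1 s, (q'.2.1 s).2⟩ x = (Z.cartierExp : ℕ)) ∧
      ((¬ ∃ g : G, S.ρ g s₁ = s ∧ A.permIdx g x₁ = x) → Z.mult ⟨q'.1 s, (q'.2.1 s).2⟩ x = 0)) :
    Quotient.mk (primarySetoid (A.phiZero S)) ⟨q, A.isPrimary_of_orbitIndicator S hq⟩ =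
        Quotient.mk (primarySetoid (A.phiZero S)) ⟨q', A.isPrimary_of_orbitIndicator S hq'⟩ ↔
      ∃ g : G, S.ρ g s₁ = s₀ ∧ A.permIdx g x₁ = x₀ :=
  ⟨fun h => A.mem_orbit_of_orbitIndicator_precsim S hq hq' (Quotient.exact h),
    fun h => Quotient.sound (A.orbitIndicator_precsim_of_mem_orbit S hq hq' h)⟩

/-- **[EtTh] Rmk. 3.3.1 at the constructed Def. 3.3 (iii) data, assembled**: the primes of `Φ₀(S)` are parametrised by
`S.V × Z.Idx`, two parameters giving the same prime iff they lie in one diagonal `G`-orbit — every prime is the class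
of the orbit indicator of some `(s₀, x₀)`, and the classes of the indicators of `(s₀, x₀)`, `(s₁, x₁)` coincide iff
`G·(s₀, x₀) = G·(s₁, x₁)`. [cite: MochizukiEtTh2009, Rmk 3.3.1 p.73] -/
theorem primes_eq_orbits :
    (∀ 𝔭 : Primes (A.phiZero S), ∃ (s₀ : S.V) (x₀ : Z.Idx) (q : A.phiZero S) (hq : ∀ s x,
        ((∃ g : G, S.ρ g s₀ = s ∧ A.permIdx g x₀ = x) → Z.mult ⟨q.1 s, (q.2.1 s).2⟩ x = (Z.cartierExp : ℕ)) ∧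
        ((¬ ∃ g : G, S.ρ g s₀ = s ∧ A.permIdx g x₀ = x) → Z.mult ⟨q.1 s, (q.2.1 s).2⟩ x = 0)),
      Quotient.mk (primarySetoid (A.phiZero S)) ⟨q, A.isPrimary_of_orbitIndicator S hq⟩ = 𝔭) ∧
    ∀ {s₀ s₁ : S.V} {x₀ x₁ : Z.Idx} {q q' : A.phiZero S}
      (hq : ∀ s x, ((∃ g : G, S.ρ g s₀ = s ∧ A.permIdx g x₀ = x) → Z.mult ⟨q.1 s, (q.2.1 s).2⟩ x = (Z.cartierExp : ℕ)) ∧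
        ((¬ ∃ g : G, S.ρ g s₀ = s ∧ A.permIdx g x₀ = x) → Z.mult ⟨q.1 s, (q.2.1 s).2⟩ x = 0))
      (hq' : ∀ s x, ((∃ g : G, S.ρ g s₁ = s ∧ A.permIdx g x₁ = x) → Z.mult ⟨q'.1 s, (q'.2.1 s).2⟩ x = (Z.cartierExp : ℕ)) ∧
        ((¬ ∃ g : G, S.ρ g s₁ = s ∧ A.permIdx g x₁ = x) → Z.mult ⟨q'.1 s, (q'.2.1 s).2⟩ x = 0)),
      (Quotient.mk (primarySetoid (A.phiZero S)) ⟨q, A.isPrimary_of_orbitIndicator S hq⟩ =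
          Quotient.mk (primarySetoid (A.phiZero S)) ⟨q', A.isPrimary_of_orbitIndicator S hq'⟩ ↔
        ∃ g : G, S.ρ g s₁ = s₀ ∧ A.permIdx g x₁ = x₀) :=
  ⟨A.exists_orbitIndicator_mk_eq S, A.orbitIndicator_mk_eq_mk_iff S⟩

end LogDivisorModel.GaloisAction

end Literature.AnabelianGeometry.EtaleTheta
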